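import Summits.CriticalPhenomena.PercolationContinuityZ3.Theorems.PercNearOneGluingNoHeavyLowerTailSahiClassTCoreReduction
import Summits.CriticalPhenomena.PercolationContinuityZ3.Theorems.PercNearOneGluingNoHeavyLowerTailSahiCombDisjunctThreeIdentities
import Summits.CriticalPhenomena.PercolationContinuityZ3.Theorems.SahiMasterFamilyL3Reduce
import Mathlib.Tactic.Linarith
import Mathlib.Tactic.Ring
import HarnessLib

/-!
# The `F`-inequality of the 0-minor core: ONE-COORDINATE BERNSTEIN FORM and the INDUCTION SKELETON

Support file (cell `prim-bnk`, seat bnk-2 gen 18; `--supports stmt-CriticalPhenomena-4575`; memo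
`run/shared/lean/prim/prim-l12/FROM-prim-bnk-2-g18-FCOMB-CENSUS.md` §7).  No definition, no `sorry`, standard axioms.

`prim-master-conj` (gen 20, `…SahiMasterFamilyZeroFlagMinorF`) reduced `MD_3` on the D0 core to the NEW conjectured 3-set inequality
  `F(A,B;G) := (1 + μG)·μ(A∩B∩G) − μG·μ(A∩B) − μ(A∩G)·μ(B∩G) ≥ 0`   (`A, B, G` increasing, product measure).
`F` is quadratic in every coordinate probability `t = p_e`; with the sections `X^b = X^{e←b}` its Bernstein form along `e` is
  `F(U) = (1−t)²·F(U⁰) + t²·F(U¹) + t(1−t)·X_e(U)`,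
  `X_e(U) = μ(A¹B¹G¹) + μ(A⁰B⁰G⁰) + μ(G¹)μ(A⁰B⁰G⁰) + μ(G⁰)μ(A¹B¹G¹) − μ(G¹)μ(A⁰B⁰) − μ(G⁰)μ(A¹B¹) − μ(A¹G¹)μ(B⁰G⁰) − μ(A⁰G⁰)μ(B¹G¹)`
(`F_bernstein_secAt`).  Hence (`F_nonneg_of_cross_step`): **if for every triple of increasing events and every coordinate `e` essential to one of
them the cross coefficient `X_e` is `≥ 0 whenever F ≥ 0` holds for all increasing triples of smaller total essential support, then `F ≥ 0` for
every increasing triple** (strong induction on the total essential support; the base case `F = 0` for constant events).  The hypothesis is exactly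
what a certificate for `X_e` from Harris inequalities and instances of `F` one dimension down (the shape found instance-by-instance by the
seat's LPs, memo §7) would discharge; all `4.7·10⁶` up-set triples of `{0,1}^4`, i.e. all nested section pairs on `{0,1}^3`, and the k ≤ 6
exhaustive comb census are consistent with it.  Appendix (same generation): along a coordinate that `G` ignores the cross coefficient is
`F(A⁰,B⁰;G) + F(A¹,B¹;G) + Δ_{AG}Δ_{BG}` (`cross_eq_of_secAt_third_eq`), hence `F ≥ 0` for all increasing triples follows from the triples with
`esupp A ∪ esupp B ⊆ esupp G` (`F_nonneg_of_absorbed_support`); Appendix 2: the ∃-form of the skeleton (`F_nonneg_of_exists_cross_step`) and the cross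
coefficient along a coordinate only `G` sees (`cross_eq_of_secAt_first_two_eq`, with its one signed term `−Δg·μ(A∩B∩ΔG)`).  HONEST FRAMING: identities and conditional reductions; `F ≥ 0` itself remains OPEN. [this work]
-/

noncomputable section

open scoped Classical

namespace Summit.CriticalPhenomena.PercolationContinuityZ3.Theorems

namespace SahiFInduction

open Finset Function
open Literature.Combinatorics.Sahi2008
open Literature.Probability.Percolation.DecisionTree (ind ind_of_mem ind_of_not_mem ind_nonneg)
open Literature.Probability.Percolation.BHK2006 (weight_nonneg)

variable {κ : Type} [Fintype κ]

/-- **One-coordinate Bernstein form of `F`.**  For any three events `A, B, G` and any coordinate `e`, writing `t = p_e`, `X^b = X^{e←b}` and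
`m = μ_p`:  `F(A,B;G) = (1−t)²·F(A⁰,B⁰;G⁰) + t²·F(A¹,B¹;G¹) + t(1−t)·X_e`, with the cross coefficient `X_e` displayed in the statement
(conditioning on `e`, `ex_ind_eq_secAt`, and `ring`). [this work] -/
theorem F_bernstein_secAt (p : κ → unitInterval) (e : κ) (A B G : Set (Set κ)) :
    (1 + ex (bernoulliWeight p) (ind G)) * ex (bernoulliWeight p) (ind (A ∩ B ∩ G))
        - ex (bernoulliWeight p) (ind G) * ex (bernoulliWeight p) (ind (A ∩ B))
        - ex (bernoulliWeight p) (ind (A ∩ G)) * ex (bernoulliWeight p) (ind (B ∩ G))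
      = (1 - (p e : ℝ)) ^ 2 *
          ((1 + ex (bernoulliWeight p) (ind (secAt e false G)))
              * ex (bernoulliWeight p) (ind (secAt e false A ∩ secAt e false B ∩ secAt e false G))
            - ex (bernoulliWeight p) (ind (secAt e false G)) * ex (bernoulliWeight p) (ind (secAt e false A ∩ secAt e false B))
            - ex (bernoulliWeight p) (ind (secAt e false A ∩ secAt e false G))
              * ex (bernoulliWeight p) (ind (secAt e false B ∩ secAt e false G)))
        + (p e : ℝ) ^ 2 *
          ((1 + ex (bernoulliWeight p) (ind (secAt e true G)))
              * ex (bernoulliWeight p) (ind (secAt e true A ∩ secAt e true B ∩ secAt e true G))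
            - ex (bernoulliWeight p) (ind (secAt e true G)) * ex (bernoulliWeight p) (ind (secAt e true A ∩ secAt e true B))
            - ex (bernoulliWeight p) (ind (secAt e true A ∩ secAt e true G))
              * ex (bernoulliWeight p) (ind (secAt e true B ∩ secAt e true G)))
        + (p e : ℝ) * (1 - (p e : ℝ)) *
          (ex (bernoulliWeight p) (ind (secAt e true A ∩ secAt e true B ∩ secAt e true G))
            + ex (bernoulliWeight p) (ind (secAt e false A ∩ secAt e false B ∩ secAt e false G))
            + ex (bernoulliWeight p) (ind (secAt e true G))
                * ex (bernoulliWeight p) (ind (secAt e false A ∩ secAt e false B ∩ secAt e false G))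
            + ex (bernoulliWeight p) (ind (secAt e false G))
                * ex (bernoulliWeight p) (ind (secAt e true A ∩ secAt e true B ∩ secAt e true G))
            - ex (bernoulliWeight p) (ind (secAt e true G)) * ex (bernoulliWeight p) (ind (secAt e false A ∩ secAt e false B))
            - ex (bernoulliWeight p) (ind (secAt e false G)) * ex (bernoulliWeight p) (ind (secAt e true A ∩ secAt e true B))
            - ex (bernoulliWeight p) (ind (secAt e true A ∩ secAt e true G))
                * ex (bernoulliWeight p) (ind (secAt e false B ∩ secAt e false G))
            - ex (bernoulliWeight p) (ind (secAt e false A ∩ secAt e false G))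
                * ex (bernoulliWeight p) (ind (secAt e true B ∩ secAt e true G))) := by
  rw [ex_ind_eq_secAt p e G, ex_ind_eq_secAt p e (A ∩ B ∩ G), ex_ind_eq_secAt p e (A ∩ B), ex_ind_eq_secAt p e (A ∩ G),
    ex_ind_eq_secAt p e (B ∩ G)]
  simp only [secAt_inter]
  ring

/-- **INDUCTION SKELETON for `F ≥ 0`.**  Fix a finite cube and a product weight `p`.  Suppose that for every triple of increasing events
`A, B, G` and every coordinate `e` essential to `A`, `B` or `G`, the cross coefficient `X_e(A,B;G)` of `F_bernstein_secAt` is `≥ 0` PROVIDED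
`F ≥ 0` holds for every triple of increasing events of strictly smaller total essential support (in particular for all triples built from the
`e`-sections).  Then `F(A,B;G) ≥ 0` for every triple of increasing events.  (Strong induction on `Σ |esupp|`; with no essential coordinate every
member is `∅` or `univ` and `F = 0`.) [this work] -/
theorem F_nonneg_of_cross_step (p : κ → unitInterval)
    (hstep : ∀ (A B G : Set (Set κ)) (e : κ), IsUpperSet A → IsUpperSet B → IsUpperSet G →
      (e ∈ esupp A ∨ e ∈ esupp B ∨ e ∈ esupp G) →
      (∀ (A' B' G' : Set (Set κ)), IsUpperSet A' → IsUpperSet B' → IsUpperSet G' →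
        (esupp A').card + (esupp B').card + (esupp G').card < (esupp A).card + (esupp B).card + (esupp G).card →
        0 ≤ (1 + ex (bernoulliWeight p) (ind G')) * ex (bernoulliWeight p) (ind (A' ∩ B' ∩ G'))
            - ex (bernoulliWeight p) (ind G') * ex (bernoulliWeight p) (ind (A' ∩ B'))
            - ex (bernoulliWeight p) (ind (A' ∩ G')) * ex (bernoulliWeight p) (ind (B' ∩ G'))) →
      0 ≤ ex (bernoulliWeight p) (ind (secAt e true A ∩ secAt e true B ∩ secAt e true G))
            + ex (bernoulliWeight p) (ind (secAt e false A ∩ secAt e false B ∩ secAt e false G))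
            + ex (bernoulliWeight p) (ind (secAt e true G))
                * ex (bernoulliWeight p) (ind (secAt e false A ∩ secAt e false B ∩ secAt e false G))
            + ex (bernoulliWeight p) (ind (secAt e false G))
                * ex (bernoulliWeight p) (ind (secAt e true A ∩ secAt e true B ∩ secAt e true G))
            - ex (bernoulliWeight p) (ind (secAt e true G)) * ex (bernoulliWeight p) (ind (secAt e false A ∩ secAt e false B))
            - ex (bernoulliWeight p) (ind (secAt e false G)) * ex (bernoulliWeight p) (ind (secAt e true A ∩ secAt e true B))
            - ex (bernoulliWeight p) (ind (secAt e true A ∩ secAt e true G))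
                * ex (bernoulliWeight p) (ind (secAt e false B ∩ secAt e false G))
            - ex (bernoulliWeight p) (ind (secAt e false A ∩ secAt e false G))
                * ex (bernoulliWeight p) (ind (secAt e true B ∩ secAt e true G))) :
    ∀ (A B G : Set (Set κ)), IsUpperSet A → IsUpperSet B → IsUpperSet G →
      0 ≤ (1 + ex (bernoulliWeight p) (ind G)) * ex (bernoulliWeight p) (ind (A ∩ B ∩ G))
          - ex (bernoulliWeight p) (ind G) * ex (bernoulliWeight p) (ind (A ∩ B))
          - ex (bernoulliWeight p) (ind (A ∩ G)) * ex (bernoulliWeight p) (ind (B ∩ G)) := by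
  suffices key : ∀ (N : ℕ) (A B G : Set (Set κ)), (esupp A).card + (esupp B).card + (esupp G).card ≤ N →
      IsUpperSet A → IsUpperSet B → IsUpperSet G →
      0 ≤ (1 + ex (bernoulliWeight p) (ind G)) * ex (bernoulliWeight p) (ind (A ∩ B ∩ G))
          - ex (bernoulliWeight p) (ind G) * ex (bernoulliWeight p) (ind (A ∩ B))
          - ex (bernoulliWeight p) (ind (A ∩ G)) * ex (bernoulliWeight p) (ind (B ∩ G)) from
    fun A B G hA hB hG => key _ A B G le_rfl hA hB hG
  intro N
  induction N with
  | zero =>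
    intro A B G hN hA hB hG
    -- no essential coordinates: every member is `∅` or `univ`, and then `F = 0`
    have hA0 : esupp A = ∅ := Finset.card_eq_zero.1 (by omega)
    have hB0 : esupp B = ∅ := Finset.card_eq_zero.1 (by omega)
    rcases eq_empty_or_univ_of_esupp_eq_empty hA hA0 with rfl | rfl
    · simp [SahiCombDisjunct.ex_ind_empty]
    · rcases eq_empty_or_univ_of_esupp_eq_empty hB hB0 with rfl | rfl
      · simp [SahiCombDisjunct.ex_ind_empty]
      · simp only [Set.univ_inter, SahiCombDisjunct.ex_ind_univ]
        nlinarith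
  | succ N ih =>
    intro A B G hN hA hB hG
    by_cases hle : (esupp A).card + (esupp B).card + (esupp G).card ≤ N
    · exact ih A B G hle hA hB hG
    · -- pick an essential coordinate `e`
      have hpos : 0 < (esupp A).card + (esupp B).card + (esupp G).card := by omega
      have hex : ∃ e, e ∈ esupp A ∨ e ∈ esupp B ∨ e ∈ esupp G := by
        by_cases h1 : (esupp A).card = 0
        · by_cases h2 : (esupp B).card = 0
          · have h3 : 0 < (esupp G).card := by omega
            obtain ⟨e, he⟩ := Finset.card_pos.1 h3
            exact ⟨e, Or.inr (Or.inr he)⟩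
          · obtain ⟨e, he⟩ := Finset.card_pos.1 (Nat.pos_of_ne_zero h2)
            exact ⟨e, Or.inr (Or.inl he)⟩
        · obtain ⟨e, he⟩ := Finset.card_pos.1 (Nat.pos_of_ne_zero h1)
          exact ⟨e, Or.inl he⟩
      obtain ⟨e, he⟩ := hex
      -- the sections have smaller total support
      have hlt : ∀ b : Bool, (esupp (secAt e b A)).card + (esupp (secAt e b B)).card + (esupp (secAt e b G)).card
          < (esupp A).card + (esupp B).card + (esupp G).card := by
        intro b
        have lA := SahiClassTCube.card_esupp_secAt_le hA e b
        have lB := SahiClassTCube.card_esupp_secAt_le hB e b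
        have lG := SahiClassTCube.card_esupp_secAt_le hG e b
        rcases he with h | h | h
        · have := SahiClassTCube.card_esupp_secAt_lt hA h b; omega
        · have := SahiClassTCube.card_esupp_secAt_lt hB h b; omega
        · have := SahiClassTCube.card_esupp_secAt_lt hG h b; omega
      have ihsec : ∀ b : Bool,
          0 ≤ (1 + ex (bernoulliWeight p) (ind (secAt e b G)))
                * ex (bernoulliWeight p) (ind (secAt e b A ∩ secAt e b B ∩ secAt e b G))
            - ex (bernoulliWeight p) (ind (secAt e b G)) * ex (bernoulliWeight p) (ind (secAt e b A ∩ secAt e b B))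
            - ex (bernoulliWeight p) (ind (secAt e b A ∩ secAt e b G))
              * ex (bernoulliWeight p) (ind (secAt e b B ∩ secAt e b G)) := fun b =>
        ih _ _ _ (by have := hlt b; omega) (isUpperSet_secAt e b hA) (isUpperSet_secAt e b hB) (isUpperSet_secAt e b hG)
      -- the cross coefficient is nonnegative by the step hypothesis (smaller triples are covered by `ih`)
      have hX := hstep A B G e hA hB hG he (fun A' B' G' hA' hB' hG' hlt' => ih A' B' G' (by omega) hA' hB' hG')
      rw [F_bernstein_secAt p e A B G]
      have ht0 : 0 ≤ (p e : ℝ) := (p e).2.1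
      have ht1 : 0 ≤ 1 - (p e : ℝ) := sub_nonneg.2 (p e).2.2
      have a0 := mul_nonneg (pow_nonneg ht1 2) (ihsec false)
      have a1 := mul_nonneg (pow_nonneg ht0 2) (ihsec true)
      have a2 := mul_nonneg (mul_nonneg ht0 ht1) hX
      linarith

/-! ### Appendix (same generation): splitting along a coordinate that the third member ignores

If `G` does not depend on `e` then the cross coefficient is `F(A⁰,B⁰;G) + F(A¹,B¹;G) + (μ(A¹G) − μ(A⁰G))(μ(B¹G) − μ(B⁰G))`, which is `≥ 0`
as soon as the two section instances of `F` are; hence **`F ≥ 0` for all increasing triples follows from `F ≥ 0` for the triples with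
`esupp A ∪ esupp B ⊆ esupp G`** ("the third member depends on every coordinate the first two depend on"), by the same induction.
[this work] -/

local notation3 (prettyPrint := false) "μ⟦" p ", " X "⟧" => ex (bernoulliWeight p) (ind X)

/-- Monotonicity of the product-weight probability under inclusion of events. [folklore] -/
private theorem ex_ind_mono_subset (p : κ → unitInterval) {X Y : Set (Set κ)} (h : X ⊆ Y) : μ⟦p, X⟧ ≤ μ⟦p, Y⟧ := by
  refine ex_mono (fun ω => weight_nonneg (fun i => (p i).2.1) (fun i => (p i).2.2) ω) (fun ω => ?_)
  by_cases hx : ω ∈ X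
  · rw [ind_of_mem hx, ind_of_mem (h hx)]
  · rw [ind_of_not_mem hx]; exact ind_nonneg Y ω

/-- **Cross coefficient along a coordinate the third member ignores.**  If `G^{e←b} = G` for both `b` then
`X_e(A,B;G) = F(A⁰,B⁰;G) + F(A¹,B¹;G) + (μ(A¹∩G) − μ(A⁰∩G))·(μ(B¹∩G) − μ(B⁰∩G))` (`ring`). [this work] -/
theorem cross_eq_of_secAt_third_eq (p : κ → unitInterval) (e : κ) (A B G : Set (Set κ)) (hG : ∀ b : Bool, secAt e b G = G) :
    μ⟦p, secAt e true A ∩ secAt e true B ∩ secAt e true G⟧ + μ⟦p, secAt e false A ∩ secAt e false B ∩ secAt e false G⟧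
        + μ⟦p, secAt e true G⟧ * μ⟦p, secAt e false A ∩ secAt e false B ∩ secAt e false G⟧
        + μ⟦p, secAt e false G⟧ * μ⟦p, secAt e true A ∩ secAt e true B ∩ secAt e true G⟧
        - μ⟦p, secAt e true G⟧ * μ⟦p, secAt e false A ∩ secAt e false B⟧
        - μ⟦p, secAt e false G⟧ * μ⟦p, secAt e true A ∩ secAt e true B⟧
        - μ⟦p, secAt e true A ∩ secAt e true G⟧ * μ⟦p, secAt e false B ∩ secAt e false G⟧
        - μ⟦p, secAt e false A ∩ secAt e false G⟧ * μ⟦p, secAt e true B ∩ secAt e true G⟧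
      = ((1 + μ⟦p, G⟧) * μ⟦p, secAt e false A ∩ secAt e false B ∩ G⟧ - μ⟦p, G⟧ * μ⟦p, secAt e false A ∩ secAt e false B⟧
            - μ⟦p, secAt e false A ∩ G⟧ * μ⟦p, secAt e false B ∩ G⟧)
        + ((1 + μ⟦p, G⟧) * μ⟦p, secAt e true A ∩ secAt e true B ∩ G⟧ - μ⟦p, G⟧ * μ⟦p, secAt e true A ∩ secAt e true B⟧
            - μ⟦p, secAt e true A ∩ G⟧ * μ⟦p, secAt e true B ∩ G⟧)
        + (μ⟦p, secAt e true A ∩ G⟧ - μ⟦p, secAt e false A ∩ G⟧) * (μ⟦p, secAt e true B ∩ G⟧ - μ⟦p, secAt e false B ∩ G⟧) := by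
  rw [hG true, hG false]
  ring

/-- **Nonnegativity of the cross coefficient along a coordinate the third member ignores**, given the two section instances of `F`
(the product term is `≥ 0` because the sections of increasing events are nested). [this work] -/
theorem cross_nonneg_of_not_mem_esupp_third (p : κ → unitInterval) (e : κ) {A B G : Set (Set κ)}
    (hA : IsUpperSet A) (hB : IsUpperSet B) (hG : IsUpperSet G) (he : e ∉ esupp G)
    (h0 : 0 ≤ (1 + μ⟦p, G⟧) * μ⟦p, secAt e false A ∩ secAt e false B ∩ G⟧ - μ⟦p, G⟧ * μ⟦p, secAt e false A ∩ secAt e false B⟧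
            - μ⟦p, secAt e false A ∩ G⟧ * μ⟦p, secAt e false B ∩ G⟧)
    (h1 : 0 ≤ (1 + μ⟦p, G⟧) * μ⟦p, secAt e true A ∩ secAt e true B ∩ G⟧ - μ⟦p, G⟧ * μ⟦p, secAt e true A ∩ secAt e true B⟧
            - μ⟦p, secAt e true A ∩ G⟧ * μ⟦p, secAt e true B ∩ G⟧) :
    0 ≤ μ⟦p, secAt e true A ∩ secAt e true B ∩ secAt e true G⟧ + μ⟦p, secAt e false A ∩ secAt e false B ∩ secAt e false G⟧
        + μ⟦p, secAt e true G⟧ * μ⟦p, secAt e false A ∩ secAt e false B ∩ secAt e false G⟧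
        + μ⟦p, secAt e false G⟧ * μ⟦p, secAt e true A ∩ secAt e true B ∩ secAt e true G⟧
        - μ⟦p, secAt e true G⟧ * μ⟦p, secAt e false A ∩ secAt e false B⟧
        - μ⟦p, secAt e false G⟧ * μ⟦p, secAt e true A ∩ secAt e true B⟧
        - μ⟦p, secAt e true A ∩ secAt e true G⟧ * μ⟦p, secAt e false B ∩ secAt e false G⟧
        - μ⟦p, secAt e false A ∩ secAt e false G⟧ * μ⟦p, secAt e true B ∩ secAt e true G⟧ := by
  have hGe : ∀ b : Bool, secAt e b G = G := fun b => secAt_eq_self_of_not_affects hG (fun h => he (mem_esupp.2 h)) b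
  rw [cross_eq_of_secAt_third_eq p e A B G hGe]
  have dA : 0 ≤ μ⟦p, secAt e true A ∩ G⟧ - μ⟦p, secAt e false A ∩ G⟧ :=
    sub_nonneg.2 (ex_ind_mono_subset p (Set.inter_subset_inter_left G (secAt_false_subset_true hA e)))
  have dB : 0 ≤ μ⟦p, secAt e true B ∩ G⟧ - μ⟦p, secAt e false B ∩ G⟧ :=
    sub_nonneg.2 (ex_ind_mono_subset p (Set.inter_subset_inter_left G (secAt_false_subset_true hB e)))
  have := mul_nonneg dA dB
  linarith

/-- **Reduction: `F ≥ 0` for all increasing triples follows from `F ≥ 0` on the triples whose third member depends on every coordinate the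
first two depend on** (`esupp A ∪ esupp B ⊆ esupp G`), where the latter may moreover use `F ≥ 0` for all increasing triples of smaller total
essential support.  (Strong induction on `Σ|esupp|`; a coordinate of `A` or `B` ignored by `G` is split with `cross_nonneg_of_not_mem_esupp_third`.)
[this work] -/
theorem F_nonneg_of_absorbed_support (p : κ → unitInterval)
    (hcore : ∀ (A B G : Set (Set κ)), IsUpperSet A → IsUpperSet B → IsUpperSet G →
      esupp A ∪ esupp B ⊆ esupp G →
      (∀ (A' B' G' : Set (Set κ)), IsUpperSet A' → IsUpperSet B' → IsUpperSet G' →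
        (esupp A').card + (esupp B').card + (esupp G').card < (esupp A).card + (esupp B).card + (esupp G).card →
        0 ≤ (1 + μ⟦p, G'⟧) * μ⟦p, A' ∩ B' ∩ G'⟧ - μ⟦p, G'⟧ * μ⟦p, A' ∩ B'⟧ - μ⟦p, A' ∩ G'⟧ * μ⟦p, B' ∩ G'⟧) →
      0 ≤ (1 + μ⟦p, G⟧) * μ⟦p, A ∩ B ∩ G⟧ - μ⟦p, G⟧ * μ⟦p, A ∩ B⟧ - μ⟦p, A ∩ G⟧ * μ⟦p, B ∩ G⟧) :
    ∀ (A B G : Set (Set κ)), IsUpperSet A → IsUpperSet B → IsUpperSet G →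
      0 ≤ (1 + μ⟦p, G⟧) * μ⟦p, A ∩ B ∩ G⟧ - μ⟦p, G⟧ * μ⟦p, A ∩ B⟧ - μ⟦p, A ∩ G⟧ * μ⟦p, B ∩ G⟧ := by
  suffices key : ∀ (N : ℕ) (A B G : Set (Set κ)), (esupp A).card + (esupp B).card + (esupp G).card ≤ N →
      IsUpperSet A → IsUpperSet B → IsUpperSet G →
      0 ≤ (1 + μ⟦p, G⟧) * μ⟦p, A ∩ B ∩ G⟧ - μ⟦p, G⟧ * μ⟦p, A ∩ B⟧ - μ⟦p, A ∩ G⟧ * μ⟦p, B ∩ G⟧ from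
    fun A B G hA hB hG => key _ A B G le_rfl hA hB hG
  intro N
  induction N with
  | zero =>
    intro A B G hN hA hB hG
    have hA0 : esupp A = ∅ := Finset.card_eq_zero.1 (by omega)
    have hB0 : esupp B = ∅ := Finset.card_eq_zero.1 (by omega)
    rcases eq_empty_or_univ_of_esupp_eq_empty hA hA0 with rfl | rfl
    · simp [SahiCombDisjunct.ex_ind_empty]
    · rcases eq_empty_or_univ_of_esupp_eq_empty hB hB0 with rfl | rfl
      · simp [SahiCombDisjunct.ex_ind_empty]
      · simp only [Set.univ_inter, SahiCombDisjunct.ex_ind_univ]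
        nlinarith
  | succ N ih =>
    intro A B G hN hA hB hG
    by_cases hle : (esupp A).card + (esupp B).card + (esupp G).card ≤ N
    · exact ih A B G hle hA hB hG
    have ih' : ∀ (A' B' G' : Set (Set κ)), IsUpperSet A' → IsUpperSet B' → IsUpperSet G' →
        (esupp A').card + (esupp B').card + (esupp G').card < (esupp A).card + (esupp B).card + (esupp G).card →
        0 ≤ (1 + μ⟦p, G'⟧) * μ⟦p, A' ∩ B' ∩ G'⟧ - μ⟦p, G'⟧ * μ⟦p, A' ∩ B'⟧ - μ⟦p, A' ∩ G'⟧ * μ⟦p, B' ∩ G'⟧ :=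
      fun A' B' G' hA' hB' hG' hlt => ih A' B' G' (by omega) hA' hB' hG'
    by_cases hfree : ∃ e, (e ∈ esupp A ∨ e ∈ esupp B) ∧ e ∉ esupp G
    · obtain ⟨e, heAB, heG⟩ := hfree
      have hGe : ∀ b : Bool, secAt e b G = G := fun b => secAt_eq_self_of_not_affects hG (fun h => heG (mem_esupp.2 h)) b
      -- the two same-`G` section instances are smaller
      have hlt : ∀ b : Bool, (esupp (secAt e b A)).card + (esupp (secAt e b B)).card + (esupp G).card
          < (esupp A).card + (esupp B).card + (esupp G).card := by
        intro b
        have lA := SahiClassTCube.card_esupp_secAt_le hA e b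
        have lB := SahiClassTCube.card_esupp_secAt_le hB e b
        rcases heAB with h | h
        · have := SahiClassTCube.card_esupp_secAt_lt hA h b; omega
        · have := SahiClassTCube.card_esupp_secAt_lt hB h b; omega
      have hsec : ∀ b : Bool, 0 ≤ (1 + μ⟦p, G⟧) * μ⟦p, secAt e b A ∩ secAt e b B ∩ G⟧ - μ⟦p, G⟧ * μ⟦p, secAt e b A ∩ secAt e b B⟧
          - μ⟦p, secAt e b A ∩ G⟧ * μ⟦p, secAt e b B ∩ G⟧ := fun b =>
        ih' _ _ _ (isUpperSet_secAt e b hA) (isUpperSet_secAt e b hB) hG (hlt b)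
      have hX := cross_nonneg_of_not_mem_esupp_third p e hA hB hG heG (hsec false) (hsec true)
      rw [F_bernstein_secAt p e A B G]
      have ht0 : 0 ≤ (p e : ℝ) := (p e).2.1
      have ht1 : 0 ≤ 1 - (p e : ℝ) := sub_nonneg.2 (p e).2.2
      have f0 : 0 ≤ (1 + μ⟦p, secAt e false G⟧) * μ⟦p, secAt e false A ∩ secAt e false B ∩ secAt e false G⟧
          - μ⟦p, secAt e false G⟧ * μ⟦p, secAt e false A ∩ secAt e false B⟧
          - μ⟦p, secAt e false A ∩ secAt e false G⟧ * μ⟦p, secAt e false B ∩ secAt e false G⟧ := by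
        rw [hGe false]; exact hsec false
      have f1 : 0 ≤ (1 + μ⟦p, secAt e true G⟧) * μ⟦p, secAt e true A ∩ secAt e true B ∩ secAt e true G⟧
          - μ⟦p, secAt e true G⟧ * μ⟦p, secAt e true A ∩ secAt e true B⟧
          - μ⟦p, secAt e true A ∩ secAt e true G⟧ * μ⟦p, secAt e true B ∩ secAt e true G⟧ := by
        rw [hGe true]; exact hsec true
      have a0 := mul_nonneg (pow_nonneg ht1 2) f0
      have a1 := mul_nonneg (pow_nonneg ht0 2) f1
      have a2 := mul_nonneg (mul_nonneg ht0 ht1) hX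
      linarith
    · -- every coordinate of `A` and `B` is a coordinate of `G`: the core hypothesis applies
      push Not at hfree
      refine hcore A B G hA hB hG (fun e he => ?_) ih'
      rcases Finset.mem_union.1 he with h | h
      · exact hfree e (Or.inl h)
      · exact hfree e (Or.inr h)

/-! ### Appendix 2 (same generation): the ∃-form of the skeleton, and the cross coefficient along a coordinate only the third member sees -/

/-- **INDUCTION SKELETON, ∃-form.**  It suffices that every increasing triple with a nonempty total essential support has SOME essential coordinate `e`
whose cross coefficient is `≥ 0` given `F ≥ 0` on all increasing triples of smaller total essential support. [this work] -/
theorem F_nonneg_of_exists_cross_step (p : κ → unitInterval)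
    (hstep : ∀ (A B G : Set (Set κ)), IsUpperSet A → IsUpperSet B → IsUpperSet G →
      0 < (esupp A).card + (esupp B).card + (esupp G).card →
      (∀ (A' B' G' : Set (Set κ)), IsUpperSet A' → IsUpperSet B' → IsUpperSet G' →
        (esupp A').card + (esupp B').card + (esupp G').card < (esupp A).card + (esupp B).card + (esupp G).card →
        0 ≤ (1 + μ⟦p, G'⟧) * μ⟦p, A' ∩ B' ∩ G'⟧ - μ⟦p, G'⟧ * μ⟦p, A' ∩ B'⟧ - μ⟦p, A' ∩ G'⟧ * μ⟦p, B' ∩ G'⟧) →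
      ∃ e, (e ∈ esupp A ∨ e ∈ esupp B ∨ e ∈ esupp G) ∧
        0 ≤ μ⟦p, secAt e true A ∩ secAt e true B ∩ secAt e true G⟧ + μ⟦p, secAt e false A ∩ secAt e false B ∩ secAt e false G⟧
            + μ⟦p, secAt e true G⟧ * μ⟦p, secAt e false A ∩ secAt e false B ∩ secAt e false G⟧
            + μ⟦p, secAt e false G⟧ * μ⟦p, secAt e true A ∩ secAt e true B ∩ secAt e true G⟧
            - μ⟦p, secAt e true G⟧ * μ⟦p, secAt e false A ∩ secAt e false B⟧
            - μ⟦p, secAt e false G⟧ * μ⟦p, secAt e true A ∩ secAt e true B⟧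
            - μ⟦p, secAt e true A ∩ secAt e true G⟧ * μ⟦p, secAt e false B ∩ secAt e false G⟧
            - μ⟦p, secAt e false A ∩ secAt e false G⟧ * μ⟦p, secAt e true B ∩ secAt e true G⟧) :
    ∀ (A B G : Set (Set κ)), IsUpperSet A → IsUpperSet B → IsUpperSet G →
      0 ≤ (1 + μ⟦p, G⟧) * μ⟦p, A ∩ B ∩ G⟧ - μ⟦p, G⟧ * μ⟦p, A ∩ B⟧ - μ⟦p, A ∩ G⟧ * μ⟦p, B ∩ G⟧ := by
  suffices key : ∀ (N : ℕ) (A B G : Set (Set κ)), (esupp A).card + (esupp B).card + (esupp G).card ≤ N →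
      IsUpperSet A → IsUpperSet B → IsUpperSet G →
      0 ≤ (1 + μ⟦p, G⟧) * μ⟦p, A ∩ B ∩ G⟧ - μ⟦p, G⟧ * μ⟦p, A ∩ B⟧ - μ⟦p, A ∩ G⟧ * μ⟦p, B ∩ G⟧ from
    fun A B G hA hB hG => key _ A B G le_rfl hA hB hG
  intro N
  induction N with
  | zero =>
    intro A B G hN hA hB hG
    have hA0 : esupp A = ∅ := Finset.card_eq_zero.1 (by omega)
    have hB0 : esupp B = ∅ := Finset.card_eq_zero.1 (by omega)
    rcases eq_empty_or_univ_of_esupp_eq_empty hA hA0 with rfl | rfl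
    · simp [SahiCombDisjunct.ex_ind_empty]
    · rcases eq_empty_or_univ_of_esupp_eq_empty hB hB0 with rfl | rfl
      · simp [SahiCombDisjunct.ex_ind_empty]
      · simp only [Set.univ_inter, SahiCombDisjunct.ex_ind_univ]
        nlinarith
  | succ N ih =>
    intro A B G hN hA hB hG
    by_cases hle : (esupp A).card + (esupp B).card + (esupp G).card ≤ N
    · exact ih A B G hle hA hB hG
    have hpos : 0 < (esupp A).card + (esupp B).card + (esupp G).card := by omega
    have ih' : ∀ (A' B' G' : Set (Set κ)), IsUpperSet A' → IsUpperSet B' → IsUpperSet G' →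
        (esupp A').card + (esupp B').card + (esupp G').card < (esupp A).card + (esupp B).card + (esupp G).card →
        0 ≤ (1 + μ⟦p, G'⟧) * μ⟦p, A' ∩ B' ∩ G'⟧ - μ⟦p, G'⟧ * μ⟦p, A' ∩ B'⟧ - μ⟦p, A' ∩ G'⟧ * μ⟦p, B' ∩ G'⟧ :=
      fun A' B' G' hA' hB' hG' hlt => ih A' B' G' (by omega) hA' hB' hG'
    obtain ⟨e, he, hX⟩ := hstep A B G hA hB hG hpos ih'
    have hlt : ∀ b : Bool, (esupp (secAt e b A)).card + (esupp (secAt e b B)).card + (esupp (secAt e b G)).card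
        < (esupp A).card + (esupp B).card + (esupp G).card := by
      intro b
      have lA := SahiClassTCube.card_esupp_secAt_le hA e b
      have lB := SahiClassTCube.card_esupp_secAt_le hB e b
      have lG := SahiClassTCube.card_esupp_secAt_le hG e b
      rcases he with h | h | h
      · have := SahiClassTCube.card_esupp_secAt_lt hA h b; omega
      · have := SahiClassTCube.card_esupp_secAt_lt hB h b; omega
      · have := SahiClassTCube.card_esupp_secAt_lt hG h b; omega
    have ihsec : ∀ b : Bool, 0 ≤ (1 + μ⟦p, secAt e b G⟧) * μ⟦p, secAt e b A ∩ secAt e b B ∩ secAt e b G⟧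
        - μ⟦p, secAt e b G⟧ * μ⟦p, secAt e b A ∩ secAt e b B⟧ - μ⟦p, secAt e b A ∩ secAt e b G⟧ * μ⟦p, secAt e b B ∩ secAt e b G⟧ := fun b =>
      ih' _ _ _ (isUpperSet_secAt e b hA) (isUpperSet_secAt e b hB) (isUpperSet_secAt e b hG) (hlt b)
    rw [F_bernstein_secAt p e A B G]
    have ht0 : 0 ≤ (p e : ℝ) := (p e).2.1
    have ht1 : 0 ≤ 1 - (p e : ℝ) := sub_nonneg.2 (p e).2.2
    have a0 := mul_nonneg (pow_nonneg ht1 2) (ihsec false)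
    have a1 := mul_nonneg (pow_nonneg ht0 2) (ihsec true)
    have a2 := mul_nonneg (mul_nonneg ht0 ht1) hX
    linarith

/-- **Cross coefficient along a coordinate the first two members ignore.**  If `A^{e←b} = A` and `B^{e←b} = B` then
`X_e(A,B;G) = F(A,B;G⁰) + F(A,B;G¹) + μ(A∩ΔG)·μ(B∩ΔG)-type product − Δg·μ(A∩B∩ΔG)`, precisely
`X_e = F(A,B;G⁰) + F(A,B;G¹) + (μ(AG¹) − μ(AG⁰))(μ(BG¹) − μ(BG⁰)) − (μ(G¹) − μ(G⁰))·(μ(ABG¹) − μ(ABG⁰))` (`ring`); the last term is the one an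
inductive proof has to pay for on such coordinates. [this work] -/
theorem cross_eq_of_secAt_first_two_eq (p : κ → unitInterval) (e : κ) (A B G : Set (Set κ))
    (hA : ∀ b : Bool, secAt e b A = A) (hB : ∀ b : Bool, secAt e b B = B) :
    μ⟦p, secAt e true A ∩ secAt e true B ∩ secAt e true G⟧ + μ⟦p, secAt e false A ∩ secAt e false B ∩ secAt e false G⟧
        + μ⟦p, secAt e true G⟧ * μ⟦p, secAt e false A ∩ secAt e false B ∩ secAt e false G⟧
        + μ⟦p, secAt e false G⟧ * μ⟦p, secAt e true A ∩ secAt e true B ∩ secAt e true G⟧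
        - μ⟦p, secAt e true G⟧ * μ⟦p, secAt e false A ∩ secAt e false B⟧
        - μ⟦p, secAt e false G⟧ * μ⟦p, secAt e true A ∩ secAt e true B⟧
        - μ⟦p, secAt e true A ∩ secAt e true G⟧ * μ⟦p, secAt e false B ∩ secAt e false G⟧
        - μ⟦p, secAt e false A ∩ secAt e false G⟧ * μ⟦p, secAt e true B ∩ secAt e true G⟧
      = ((1 + μ⟦p, secAt e false G⟧) * μ⟦p, A ∩ B ∩ secAt e false G⟧ - μ⟦p, secAt e false G⟧ * μ⟦p, A ∩ B⟧
            - μ⟦p, A ∩ secAt e false G⟧ * μ⟦p, B ∩ secAt e false G⟧)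
        + ((1 + μ⟦p, secAt e true G⟧) * μ⟦p, A ∩ B ∩ secAt e true G⟧ - μ⟦p, secAt e true G⟧ * μ⟦p, A ∩ B⟧
            - μ⟦p, A ∩ secAt e true G⟧ * μ⟦p, B ∩ secAt e true G⟧)
        + (μ⟦p, A ∩ secAt e true G⟧ - μ⟦p, A ∩ secAt e false G⟧) * (μ⟦p, B ∩ secAt e true G⟧ - μ⟦p, B ∩ secAt e false G⟧)
        - (μ⟦p, secAt e true G⟧ - μ⟦p, secAt e false G⟧) * (μ⟦p, A ∩ B ∩ secAt e true G⟧ - μ⟦p, A ∩ B ∩ secAt e false G⟧) := by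
  rw [hA true, hA false, hB true, hB false]
  ring

end SahiFInduction

end Summit.CriticalPhenomena.PercolationContinuityZ3.Theorems
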